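import Summits.CriticalPhenomena.PercolationContinuityZ3.Theorems.Transplant.PlanarSkeletonFrmQuasiDefs
import Summits.CriticalPhenomena.PercolationContinuityZ3.Theorems.Transplant.SkelFrmQuasiBChoiceResidC
import Summits.CriticalPhenomena.PercolationContinuityZ3.Theorems.Transplant.SkelFrmBChoiceResidC
import Summits.CriticalPhenomena.PercolationContinuityZ3.Theorems.Transplant.SkelFrmQuasiBChoiceDepth2
import Summits.CriticalPhenomena.PercolationContinuityZ3.Theorems.Transplant.SkelFrmBChoiceDepth2
import Summits.CriticalPhenomena.PercolationContinuityZ3.Theorems.Transplant.SkelFrmQuasiBChoiceDepthYW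
import Summits.CriticalPhenomena.PercolationContinuityZ3.Theorems.Transplant.SkelFrmBChoiceDepthYW
import Summits.CriticalPhenomena.PercolationContinuityZ3.Theorems.Transplant.SkelFrmQuasiBChoiceWindow3
import Summits.CriticalPhenomena.PercolationContinuityZ3.Theorems.Transplant.SkelFrmBChoiceWindow3
import Summits.CriticalPhenomena.PercolationContinuityZ3.Theorems.Transplant.SkelFrmQuasiBChoiceRootLanding2
import Summits.CriticalPhenomena.PercolationContinuityZ3.Theorems.Transplant.SkelFrmBChoiceRootLanding2
import Summits.CriticalPhenomena.PercolationContinuityZ3.Theorems.Transplant.SkelFrmQuasiBChoiceRootRunY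
import Summits.CriticalPhenomena.PercolationContinuityZ3.Theorems.Transplant.SkelFrmBChoiceRootRunY
import Summits.CriticalPhenomena.PercolationContinuityZ3.Theorems.Transplant.SkelFrmQuasiBChoiceRootPrefix
import Summits.CriticalPhenomena.PercolationContinuityZ3.Theorems.Transplant.SkelFrmBChoiceRootPrefix
import Summits.CriticalPhenomena.PercolationContinuityZ3.Theorems.Transplant.SkelFrmQuasi1ChoiceDefs
import Summits.CriticalPhenomena.PercolationContinuityZ3.Theorems.Transplant.SkelFrmQuasi1ParamsLBL
import Summits.CriticalPhenomena.PercolationContinuityZ3.Theorems.Transplant.SkelFrmQuasi1SlotTypes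
import Summits.CriticalPhenomena.PercolationContinuityZ3.Theorems.Transplant.SkelFrmQuasiBParamsBridge0
import Summits.CriticalPhenomena.PercolationContinuityZ3.Theorems.Transplant.SkelFrmQuasiBParamsCorrKG
import Summits.CriticalPhenomena.PercolationContinuityZ3.Theorems.Transplant.SkelFrmQuasiBParamsCorrKGLen3
import Summits.CriticalPhenomena.PercolationContinuityZ3.Theorems.Transplant.SkelFrmQuasiBParamsLF
import Summits.CriticalPhenomena.PercolationContinuityZ3.Theorems.Transplant.SkelFrmQuasiBParamsSlotsS
import Summits.CriticalPhenomena.PercolationContinuityZ3.Theorems.Transplant.SkelFrmQuasi1SlotTypes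
import HarnessLib
import Summits.CriticalPhenomena.PercolationContinuityZ3.Theorems.Transplant.SkelFrmBChoiceResidR
/-!
# GEN-Q PORT (WAVE-Q table v0.8 section 2, row G160, U-level L18; captain R-6/R-7 2026-08-27: carrier token swap `PlanarSkeletonFrmFrom ↦ PlanarSkeletonFrmQuasi`)
# of the tree module «Transplant/SkelFrmFromBChoiceResidR» (sha256 c2ad827db2a6d7d6…) onto the quasi-step carrier `PlanarSkeletonFrmQuasi` (p507026): «SkelFrmQuasiBChoiceResidR»

ORIGINAL TITLE: N2 (frames-only node `SamePDropOfSkeletonFrm₁`, OPEN), (R) column — **THE (R) RESIDUAL SLOT FUNCTIONS OF RECORD** for stmt's parametric unions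

builds on p205010 (kernel theorem, internal audit signed; external expert review pending) — nothing in this file uses p205010; NOTHING is claimed about any open node
((N3-b), the end state).  Lane `prim-bschramm`, seat `prim-bschramm-p3` (gen 30; design owner; tool = captain gen-1 g4's port_genq.py R-14 --cone + p3-g30 slot-value patch T1).  Helper file (`--supports stmt-CriticalPhenomena-4575 --as helper`).
PORT RULES (U-wave r1–r4 re-used, GEN-Q hunk classes of p3-g29 #6136): declaration order, names and proof texts are those of «SkelFrmFromBChoiceResidR», byte-identical except
(i) the carrier token `PlanarSkeletonFrmFrom ↦ PlanarSkeletonFrmQuasi` in binders, `namespace`/`end` lines and qualified names (module names `SkelFrmFrom… ↦ SkelFrmQuasi…`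
in imports of already-ported rows); (ii) `Φ.step ↦ Φ.qstep` with the called Steps lemma replaced by its `…Q`/`_q` twin and the cost `Φ.M` threaded (none in this file unless
listed below); (iii) `Φ.cyl_connected ↦ Φ.cyl_reach` readers (none unless listed); (iv) graph-ball radii / window floors ×`Φ.M` — IN THIS FILE the (R) excess residual `exR0`'s run-frame summands `Φ.M·13·kgSL(…)+1`, `13·nL+1 ↦ Φ.M·13·…` (left-assoc `Φ.M * 13 * x`, the Root tops' `hexZ/hexY` binder spelling, gen-2 #6411 / p5 ⑤); (v) L-KitS-1 (design-owner ruling 2026-08-27): the (S0) kit data of «SkelFrmQuasiBChoiceNums» (stmt-g33, G017) are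
N-parametrised — IN THIS FILE the readers `KS0.R'0/r₀0/r₀0_ge/base0/reach0 ↦ …N` resp. `KS.RA' ↦ KS.RAN'`, instantiated at `N := KS.NQ Φ = 13·max Φ.M 1`, nothing else.  Carrier-free
residents stay imported/exported from the original «SkelFrmBChoiceResidR» exactly as in the FrmFrom port.  Docstrings and citations are the original's.

-/

noncomputable section

open scoped Classical

namespace Summit.CriticalPhenomena.PercolationContinuityZ3.Theorems.Transplant

namespace PlanarSkeletonFrmQuasi

namespace NegB

open Literature.Probability.Percolation Literature.Probability.LatticeModels SimpleGraph
open SkelConc (Consts)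
open Skelφ (kgSL)
open Neg


-- GEN-Q T3 (p3-g30): residents/aliases of the row-less module(s) «SkelFrmFromBParamsKitA» used below, re-exported here.
export PlanarSkeletonFrmFrom.NegB (Rs)

/-- **The (R) box residual** `gxR0 mk := 60·(Rs mk + 1)` ((R-46)(g): `M_L ≥ g ≥ 60(Rs+1)` ⇒ `sL ≥ 30·Rs + 28`). [this work] -/
def gxR0 (mk : ℕ) : Neg.FSlot := fun _ _ _ _ _ _ _ t _ D => 60 * (KS.Rs t D mk + 1)

/-- **The (R) width residual** `fxR mk := KS.fxR0 mk = Rs + R′0 + prB0 + 1` (Bridge0). [this work] -/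
def fxR (mk : ℕ) : Neg.FSlot := fun κ _ _ _ _ _ Φ t p D => KS.fxR0 κ Φ t p D mk

/-- **The (R) excess residual**: the max of the six excess floors of the two `_of_le` wrappers (see the module docstring). [this work] -/
def exR0 (mk : ℕ) : GSlot := fun κ _ _ _ _ _ Φ t p D g f =>
  max (KS0.r₀0N (KS.NQ Φ) t D mk (RLD κ Φ t p D g f) + 1) (max (KS0.r₀0N (KS.NQ Φ) t D mk (KS.RB0 κ Φ t p D mk) + 1) (max (Φ.M * KS.Yb0 κ Φ t p D mk g f + 1)
    (max (Φ.M * KS.D0s κ Φ t p D mk g f (kgq κ Φ t p D g f (qxQ4 κ Φ t p D g f)) + ZD2 κ Φ t p D g f + Φ.M * 13 * (kgSL (nL κ Φ t p D g f) (ℓL κ Φ t p D g f) (hL κ Φ t p D g f)).toNat + 1)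
    (max (Φ.M * KS.D0s κ Φ t p D mk g f (kgq κ Φ t p D g f 0) + KS.ZDP κ Φ t p D g f + 1)
      (Φ.M * KS.D2R κ Φ t p D mk g f (WxYQ4 κ Φ t p D g f) + ZDYW κ Φ t p D g f + Φ.M * 13 * nL κ Φ t p D g f + 1)))))

/-- **The (R) extra-pair slot** `PxR mk := KS.Px0 mk` (the root bridge pair; ChoiceBridge0's `hPx`). [this work] -/
def PxR (mk : ℕ) : PSlot := KS.Px0 mk

-- GEN-Q (R-2, captain 2026-08-27): `PlanarSkeletonFrmFrom.NegB.mxR` is not in the used cone of the node top — not ported.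

section Floors

variable (κ : Consts) {V : Type} [DecidableEq V] [Countable V] {G : SimpleGraph V} [G.LocallyFinite] (Φ : PlanarSkeletonFrmQuasi G) (t : V) (p : unitInterval)
  (D : Skelφ.StepI.DataNS V) (mk g f : ℕ)

-- GEN-Q (R-2, captain 2026-08-27): `PlanarSkeletonFrmFrom.NegB.gxR0_at` is not in the used cone of the node top — not ported.

-- GEN-Q (R-2, captain 2026-08-27): `PlanarSkeletonFrmFrom.NegB.fxR_at` is not in the used cone of the node top — not ported.

-- GEN-Q (R-2, captain 2026-08-27): `PlanarSkeletonFrmFrom.NegB.PxR_at` is not in the used cone of the node top — not ported.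

-- GEN-Q (R-2, captain 2026-08-27): `PlanarSkeletonFrmFrom.NegB.mxR_at` is not in the used cone of the node top — not ported.

/-- **The six (R) excess floors from `exR0 mk ≤ ex`** (in the order `hexRL`, `hexRB`, `hexYb`, `hexZ`, `hexP`, `hexY`). [folklore] -/
theorem exR0_floors (κ : Consts) {V : Type} [DecidableEq V] [Countable V] {G : SimpleGraph V} [G.LocallyFinite] (Φ : PlanarSkeletonFrmQuasi G) (t : V) (p : unitInterval) (D : Skelφ.StepI.DataNS V) (mk : ℕ) (g : ℕ) (f : ℕ) {ex : ℕ} (h : exR0 mk κ Φ t p D g f ≤ ex) :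
    KS0.r₀0N (KS.NQ Φ) t D mk (RLD κ Φ t p D g f) + 1 ≤ ex ∧ KS0.r₀0N (KS.NQ Φ) t D mk (KS.RB0 κ Φ t p D mk) + 1 ≤ ex ∧ Φ.M * KS.Yb0 κ Φ t p D mk g f + 1 ≤ ex ∧
    Φ.M * KS.D0s κ Φ t p D mk g f (kgq κ Φ t p D g f (qxQ4 κ Φ t p D g f)) + ZD2 κ Φ t p D g f +
        Φ.M * 13 * (kgSL (nL κ Φ t p D g f) (ℓL κ Φ t p D g f) (hL κ Φ t p D g f)).toNat + 1 ≤ ex ∧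
    Φ.M * KS.D0s κ Φ t p D mk g f (kgq κ Φ t p D g f 0) + KS.ZDP κ Φ t p D g f + 1 ≤ ex ∧
    Φ.M * KS.D2R κ Φ t p D mk g f (WxYQ4 κ Φ t p D g f) + ZDYW κ Φ t p D g f + Φ.M * 13 * nL κ Φ t p D g f + 1 ≤ ex := by
  unfold exR0 at h
  simp only [max_le_iff] at h
  obtain ⟨h1, h2, h3, h4, h5, h6⟩ := h
  exact ⟨h1, h2, h3, h4, h5, h6⟩

-- GEN-Q (R-2, captain 2026-08-27): `PlanarSkeletonFrmFrom.NegB.exR0_floors_self` is not in the used cone of the node top — not ported.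

-- GEN-Q (R-2, captain 2026-08-27): `PlanarSkeletonFrmFrom.NegB.hgR_of_ge` is not in the used cone of the node top — not ported.

-- GEN-Q (R-2, captain 2026-08-27): `PlanarSkeletonFrmFrom.NegB.hf_of_ge` is not in the used cone of the node top — not ported.

end Floors

end NegB

end PlanarSkeletonFrmQuasi

end Summit.CriticalPhenomena.PercolationContinuityZ3.Theorems.Transplant

end
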